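import Literature.NumberTheory.EllipticCurves.ZhangLevelRaisedKolyvaginData
import Literature.NumberTheory.EllipticCurves.LevelSelmerLocalConditions
import Literature.NumberTheory.EllipticCurves.SelmerGaloisAction
import HarnessLib

/-!
# W. Zhang 2014, §8.1 property (1) + (8.1), Thm. 4.3 (4.3), Thm. 5.2, and the sign of complex conjugation —
# the LOCAL CONDITIONS of the level-raised Kolyvagin classes `c(n, m)`, as PREDICATES on a
# `ZhangLevelRaisedKolyvaginData`

Topic `Literature/NumberTheory/EllipticCurves`, story `WZhang2014/` (W. Zhang, *Selmer groups and the indivisibility of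
Heegner points*, Camb. J. Math. **2** (2014) 191–253 [WZhang2014]; held text `paper:doi-10-4310-cjm-2014-v2-n2-a2`, printed
page = file page + 190).  DEFINITIONS (predicates with bodies) and their `Iff.rfl` unfoldings only: no named fact, no `sorry`,
no instance, no notation.  NOTHING IS ASSERTED to hold: the datum `d : ZhangLevelRaisedKolyvaginData N W K a p yK` is FREE
data (its fields pin only the residual Hecke eigensystems and the bottom class `c(1, 1) = δ y_K`), so a statement of the shape
`∀ d, property (1) holds for d` would be FALSE; the printed theorems are to be asserted EXISTENTIALLY — «there is a datum `d`
(Thm. 2.1 + §3) satisfying the predicates below (§8.1, Thm. 4.3, Thm. 5.2) and the reciprocity laws (Thm. 4.3 (4.5))» — in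
ONE named fact over these predicates (sibling file, the existence statement), which is why the properties are recorded here
as predicates and not as facts.  Consumer: the Summit-side dictionary of route `AdditiveKolyvaginRoad` (crux
stmt-BirchSwinnertonDyer-21396, stub S5a `stub_lenderBipartiteDatum` of line `epsilon_matched_retyping`: the LENDER's
bipartite datum K1(E₀) at a `p`-GOOD level), whose hypothesis rows (Koff), (T), (Tr), (Rel), (S) these predicates match
one-to-one (level `(p : ℤ)` here, `((p ^ 1 : ℕ) : ℤ)` there; `toricLocalCondition` ∕ `transverseLocalCondition` here =
the Summit-side `toricLocalKer` ∕ `transverseLocalKerP` by `rfl`).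

## The printed statements (verbatim) and the transcription

Setting (Notations (i), (iv)–(xiv), pp. 200–202): `g = f_E` the newform of an elliptic curve `E/ℚ` of conductor `N`
(model `W`), `p ≥ 5`, `(p, N) = 1`, *"The modular form `g` is assumed to be good ordinary at `p`"* (Notations (v)),
`ρ̄_{E,p}` surjective (ix), `K` imaginary quadratic with `(D, N) = 1`, `N⁻` square-free (x); `n ∈ Λ` square-free products of
Kolyvagin primes (xii) — tree `IsKolyvaginLevel N W K p n`; `m ∈ Λ'` square-free products of admissible primes (xiv) — tree
`IsZhangAdmissibleLevel N K a p m` (`a ℓ = a_ℓ(E)`), `m ∈ Λ'^+` iff `ν(m)` even; the classes `c(n, m) ∈ H¹(K, V)`,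
`V = E[p]` (§3.9 (3.30)) — tree `d.kolyvaginClass m n : galH1Torsion (W.baseChange K) p` for a datum
`d : ZhangLevelRaisedKolyvaginData N W K a p yK`.  The predicates quantify over the NON-EMPTY EVEN admissible levels `m`
(the classes at `m = ∅` = `1` are Kolyvagin's classical classes, Gross 1991, whose local behaviour the tree already has) and
over `n ∈ Λ`; places of `K` are `v : HeightOneSpectrum (𝓞 K)`, «`v` above the rational prime `ℓ`» is `(ℓ : 𝓞 K) ∈ v.asIdeal`.

* §8.1, p. 235 (for the Kolyvagin system `κ_m = {c(n, m)}` of the level-raised `A = A_{g_m}`, §4.2 p. 218): *"In general, for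
  every prime `ℓ` (not necessarily in `Λ`), the finite part `H¹_fin(K_ℓ, V)` is, by definition, the local condition
  `L_{ℓ,A,0} ⊂ H¹(K_ℓ, V)` (cf. Theorem 5.2).  The collection `κ = {c(n) ∈ H¹(K, V) : n ∈ Λ}` has the following
  properties: (1) For every prime `ℓ` (not only those in `Λ`) and `n ∈ Λ`, we have `loc_ℓ(c(n)) ∈ H¹_fin(K_ℓ, V)` if
  `(ℓ, n) = 1`; `∈ H¹_tr(K_ℓ, V)` if `ℓ ∣ n`.  (2) For each prime `ℓ ∈ Λ`, there is a finite/singular homomorphism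
  `ψ_ℓ : H¹_fin(K_ℓ, V) → H¹_tr(K_ℓ, V)` which is an isomorphism such that for all `n ∈ Λ` with `(n, ℓ) = 1`
  (8.1) `loc_ℓ(c(nℓ)) = ψ_ℓ(loc_ℓ(c(n)))`."*
* Thm. 5.2, p. 223 (`A` of level `N`, `A′` of level `N q`, `q` admissible): *"For all primes `ℓ` (not only those in `Λ`),
  the local conditions `L_{ℓ,A}` and `L_{ℓ,A′}` all have `k₀`-rational structure … Moreover, we have when `ℓ ≠ q`
  `L_{ℓ,A,0} = L_{ℓ,A′,0}`, and when `ℓ = q`: `L_{q,A,0} = H¹(K_q, k₀)`, `L_{q,A′,0} = H¹(K_q, k₀(1))`."*  Iterated along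
  `m`: at a place `v` above no prime of `m`, `L_{v,A_m,0} = L_{v,E,0}` = E's KUMMER condition (tree `selmerLocalKer`); at
  `q ∈ m`, `L_{q,A_m,0} = H¹(K_q, k₀(1))` = the TORIC line of §4.1 (4.1)–(4.2), Lemma 4.2 — tree `toricLocalCondition`
  (also Thm. 4.3 (4.3), p. 218: *"`loc_{q₂}(c(n, m q₁ q₂)) ∈ H¹(K_{q₂}, k₀(1))`"*).  `H¹_tr` — tree
  `transverseLocalCondition` (§8.1: *"the transverse part, i.e. the subspace inflated from `H¹(K[ℓ]_λ/K_λ, V)`"*).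
* Sign (Gross 1991 Prop. 5.4 (2); Zhang §3.5 (3.15) `ε(A_m/K) = (−1)^{#Σ⁻}` and §8.2 p. 237, proof of Lemma 8.4: the
  classes `c(n, m)` are eigenvectors of complex conjugation `τ ∈ Gal(K/ℚ)`, the sign alternating with the parity of
  `ν(n)`): `τ · c(n, m) = ε_m · (−1)^{ν(n)} · c(n, m)` for a sign `ε_m` depending on the level only — tree `conjAct W c p`.

TRANSCRIPTION (zero-pattern forms, the currency of the consumer): property (1) off ↦ `IsKummerOffLevel` (places above no
prime of `n` and no prime of `m`) and `IsToricOnLevel` (places above `q ∈ m`) and `IsTransverseOnConductor` (places above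
`ℓ ∣ n`); (8.1) with `ψ_ℓ` an ISOMORPHISM ↦ `HasKolyvaginRelation`: `loc_ℓ c(nℓ, m) = 0 ⟺ loc_ℓ c(n, m) = 0` (all the
consumer uses; tree `WeierstrassCurve.torsionLocalKer` = kernel of `loc`); sign ↦ `HasConjSign c ε`.
-- TODO(general form): `N⁻ ≠ 1` (Shimura curves at the bottom level), and (8.1) as an EQUALITY through a typed `ψ_ℓ`.

## References
* [WZhang2014] §4.1 (4.1)–(4.2), Lemma 4.2 (p. 217); Thm. 4.3 (4.3) (p. 218); §5.1, Thm. 5.2 (pp. 222–223); §8.1 property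
  (1), (8.1) (p. 235); §8.2 (p. 237).
* [GrossLMS1991] B. H. Gross, *Kolyvagin's work on modular elliptic curves* (1991), Prop. 3.7, §4 (4.4), Prop. 5.4 (2),
  Prop. 6.2.
* [McCallumLMS1991] W. G. McCallum, *Kolyvagin's work on Shafarevich–Tate groups* (1991), §4 Prop. 4.4 (`φ_ℓ` iso).
* [BertoliniDarmon2005] §2.2–§2.3 (ordinary condition at the level primes).
-/

noncomputable section

open scoped Classical

open _root_.WeierstrassCurve _root_.NumberField _root_.IsDedekindDomain

universe u

namespace Literature.NumberTheory.EllipticCurves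

namespace ZhangLevelRaisedKolyvaginData

variable {N : ℕ} {W : WeierstrassCurve ℚ} {K : Type} [Field K] [NumberField K] {a : ℕ → ℤ} {p : ℕ} [Fact p.Prime]
  {yK : (W.baseChange K).toAffine.Point}

/-- **§8.1 property (1), FINITE part off the conductor and off the level** (with Thm. 5.2 `L_{ℓ,A_m,0} = L_{ℓ,E,0}` for
`ℓ ∤ m`): at every non-empty even admissible level `m` and every `n ∈ Λ`, the class `c(n, m)` satisfies E's KUMMER
condition (tree `selmerLocalKer`) at every finite place `v` of `K` lying above no prime factor of `n` and no prime of `m`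
— verbatim *"`loc_ℓ(c(n)) ∈ H¹_fin(K_ℓ, V)` if `(ℓ, n) = 1`"* read for `κ_m` at the places off `m` (this includes the
places above `p` and above `N`). [cite: WZhang2014, §8.1 property (1) (p. 235); Thm. 5.2 (p. 223)] -/
def IsKummerOffLevel (d : ZhangLevelRaisedKolyvaginData N W K a p yK) : Prop :=
  ∀ m : Finset ℕ, IsZhangAdmissibleLevel N K a p m → m.Nonempty → Even m.card →
    ∀ n : ℕ, IsKolyvaginLevel N W K p n →
    ∀ v : HeightOneSpectrum (𝓞 K), (∀ ℓ ∈ n.primeFactors, (ℓ : 𝓞 K) ∉ v.asIdeal) → (∀ q ∈ m, (q : 𝓞 K) ∉ v.asIdeal) →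
      d.kolyvaginClass m n ∈ selmerLocalKer (W.baseChange K) (v.adicCompletion K) (p : ℤ)

/-- **§8.1 property (1) at the LEVEL primes — the TORIC condition** (Thm. 5.2: `L_{q,A′,0} = H¹(K_q, k₀(1))` at the raised
prime `q`; Thm. 4.3 (4.3): *"`loc_{q₂}(c(n, m q₁ q₂)) ∈ H¹(K_{q₂}, k₀(1))`"*; §4.1 Lemma 4.2: `k₀(1)` = the line with
non-trivial `Gal_{K_q}`-action = the singular ∕ Bertolini–Darmon ordinary part): at every non-empty even admissible level
`m`, every `n ∈ Λ` and every `q ∈ m`, the class `c(n, m)` lies in the toric condition (tree `toricLocalCondition`, the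
augmentation-line-valued classes) at the place above `q`.
[cite: WZhang2014, Thm. 4.3 (4.3) (p. 218); Thm. 5.2 (p. 223); §4.1 Lemma 4.2 (p. 217)]
[cite: BertoliniDarmon2005, §2.2–§2.3 (H¹_ord)] -/
def IsToricOnLevel (d : ZhangLevelRaisedKolyvaginData N W K a p yK) : Prop :=
  ∀ m : Finset ℕ, IsZhangAdmissibleLevel N K a p m → m.Nonempty → Even m.card →
    ∀ n : ℕ, IsKolyvaginLevel N W K p n → ∀ q ∈ m,
    ∀ v : HeightOneSpectrum (𝓞 K), (q : 𝓞 K) ∈ v.asIdeal →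
      d.kolyvaginClass m n ∈ (W.baseChange K).toricLocalCondition (v.adicCompletion K) (p : ℤ)

/-- **§8.1 property (1), TRANSVERSE part on the conductor**: at every non-empty even admissible level `m`, every `n ∈ Λ`
and every prime `ℓ ∣ n`, the class `c(n, m)` is TRANSVERSE at the place above `ℓ` — verbatim *"`loc_ℓ(c(n)) ∈ H¹_tr(K_ℓ, V)`
if `ℓ ∣ n`"*, *"`H¹_tr` … the subspace inflated from `H¹(K[ℓ]_λ/K_λ, V)`"* (tree `transverseLocalCondition`, Gross's
pairing currency along `ι : K →+* ℂ` which fixes the ring class fields `K[ℓ] ⊂ ℂ`).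
[cite: WZhang2014, §8.1 property (1) (p. 235)] [cite: GrossLMS1991, §3–§4 (4.4)] -/
def IsTransverseOnConductor (d : ZhangLevelRaisedKolyvaginData N W K a p yK) (ι : K →+* ℂ) : Prop :=
  ∀ m : Finset ℕ, IsZhangAdmissibleLevel N K a p m → m.Nonempty → Even m.card →
    ∀ n : ℕ, IsKolyvaginLevel N W K p n → ∀ ℓ ∈ n.primeFactors,
    ∀ v : HeightOneSpectrum (𝓞 K), (ℓ : 𝓞 K) ∈ v.asIdeal →
      d.kolyvaginClass m n ∈ transverseLocalCondition W K ι (p : ℤ) ℓ v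

/-- **§8.1 (2), the relation (8.1) `loc_ℓ(c(nℓ)) = ψ_ℓ(loc_ℓ(c(n)))` with `ψ_ℓ` an ISOMORPHISM, in zero-pattern form**:
at every non-empty even admissible level `m`, for `n ∈ Λ` and a Kolyvagin prime `ℓ ∤ n` (tree `IsKolyvaginPrime`, Gross (3.1)–(3.2); so `nℓ ∈ Λ`), the localisation of
`c(nℓ, m)` at the place above `ℓ` vanishes iff that of `c(n, m)` does (tree `WeierstrassCurve.torsionLocalKer` = the classes
with `loc_v = 0`).  This is all of (8.1) that the induction of §9 consumes.
-- TODO(general form): (8.1) as an equality through a typed finite/singular isomorphism `ψ_ℓ` (McCallum Prop. 4.4).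
[cite: WZhang2014, §8.1 (2), (8.1) (p. 235)] [cite: McCallumLMS1991, §4 Prop. 4.4] -/
def HasKolyvaginRelation (d : ZhangLevelRaisedKolyvaginData N W K a p yK) : Prop :=
  ∀ m : Finset ℕ, IsZhangAdmissibleLevel N K a p m → m.Nonempty → Even m.card →
    ∀ n ℓ : ℕ, IsKolyvaginLevel N W K p n → IsKolyvaginPrime N W K p ℓ → ¬ ℓ ∣ n →
    ∀ v : HeightOneSpectrum (𝓞 K), (ℓ : 𝓞 K) ∈ v.asIdeal →
      (d.kolyvaginClass m (n * ℓ) ∈ (W.baseChange K).torsionLocalKer (v.adicCompletion K) (p : ℤ) ↔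
        d.kolyvaginClass m n ∈ (W.baseChange K).torsionLocalKer (v.adicCompletion K) (p : ℤ))

/-- **The sign of complex conjugation on the level-raised classes** (Gross 1991 Prop. 5.4 (2) at level `1`; at level `m`
Zhang §3.5 (3.15) `ε(A_m/K)` and §8.2 p. 237: `c(n, m)` lies in the `τ`-eigenspace of sign `ε_m · (−1)^{ν(n)}`): for
`c ∈ Aut(K/ℚ)` (complex conjugation) and a sign function `ε` on levels, at every non-empty even admissible level `m` and
every `n ∈ Λ`, `τ · c(n, m) = s · c(n, m)` with `s = +1` if `ε m` XOR «`ν(n)` odd» is `true`, `−1` otherwise — tree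
`conjAct W c p` (Gross (5.1), the action of `Gal(K/ℚ)` on `H¹(K, E[p])`), `ν(n) = n.primeFactors.card`; the consumer's
`sgnP (ε m ^^ Nat.bodd ν(n))` convention. [cite: GrossLMS1991, Prop. 5.4 (2)] [cite: WZhang2014, §3.5 (3.15); §8.2 (p. 237)] -/
def HasConjSign (d : ZhangLevelRaisedKolyvaginData N W K a p yK) (c : K ≃ₐ[ℚ] K) (ε : Finset ℕ → Bool) : Prop :=
  ∀ m : Finset ℕ, IsZhangAdmissibleLevel N K a p m → m.Nonempty → Even m.card →
    ∀ n : ℕ, IsKolyvaginLevel N W K p n →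
      conjAct W c (p : ℤ) (d.kolyvaginClass m n) =
        (if (ε m ^^ Nat.bodd n.primeFactors.card) then (1 : ℤ) else -1) • d.kolyvaginClass m n

/-! ### Unfolding lemmas (definitional) -/

/-- Unfolding `IsKummerOffLevel`. [cite: WZhang2014, §8.1 property (1) (p. 235)] -/
theorem isKummerOffLevel_iff (d : ZhangLevelRaisedKolyvaginData N W K a p yK) : d.IsKummerOffLevel ↔
    ∀ m : Finset ℕ, IsZhangAdmissibleLevel N K a p m → m.Nonempty → Even m.card →
    ∀ n : ℕ, IsKolyvaginLevel N W K p n →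
    ∀ v : HeightOneSpectrum (𝓞 K), (∀ ℓ ∈ n.primeFactors, (ℓ : 𝓞 K) ∉ v.asIdeal) → (∀ q ∈ m, (q : 𝓞 K) ∉ v.asIdeal) →
      d.kolyvaginClass m n ∈ selmerLocalKer (W.baseChange K) (v.adicCompletion K) (p : ℤ) :=
  Iff.rfl

/-- Unfolding `IsToricOnLevel`. [cite: WZhang2014, Thm. 4.3 (4.3) (p. 218); Thm. 5.2 (p. 223)] -/
theorem isToricOnLevel_iff (d : ZhangLevelRaisedKolyvaginData N W K a p yK) : d.IsToricOnLevel ↔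
    ∀ m : Finset ℕ, IsZhangAdmissibleLevel N K a p m → m.Nonempty → Even m.card →
    ∀ n : ℕ, IsKolyvaginLevel N W K p n → ∀ q ∈ m,
    ∀ v : HeightOneSpectrum (𝓞 K), (q : 𝓞 K) ∈ v.asIdeal →
      d.kolyvaginClass m n ∈ (W.baseChange K).toricLocalCondition (v.adicCompletion K) (p : ℤ) :=
  Iff.rfl

/-- Unfolding `IsTransverseOnConductor`. [cite: WZhang2014, §8.1 property (1) (p. 235)] -/
theorem isTransverseOnConductor_iff (d : ZhangLevelRaisedKolyvaginData N W K a p yK) (ι : K →+* ℂ) : d.IsTransverseOnConductor ι ↔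
    ∀ m : Finset ℕ, IsZhangAdmissibleLevel N K a p m → m.Nonempty → Even m.card →
    ∀ n : ℕ, IsKolyvaginLevel N W K p n → ∀ ℓ ∈ n.primeFactors,
    ∀ v : HeightOneSpectrum (𝓞 K), (ℓ : 𝓞 K) ∈ v.asIdeal →
      d.kolyvaginClass m n ∈ transverseLocalCondition W K ι (p : ℤ) ℓ v :=
  Iff.rfl

/-- Unfolding `HasKolyvaginRelation`. [cite: WZhang2014, §8.1 (8.1) (p. 235)] -/
theorem hasKolyvaginRelation_iff (d : ZhangLevelRaisedKolyvaginData N W K a p yK) : d.HasKolyvaginRelation ↔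
    ∀ m : Finset ℕ, IsZhangAdmissibleLevel N K a p m → m.Nonempty → Even m.card →
    ∀ n ℓ : ℕ, IsKolyvaginLevel N W K p n → IsKolyvaginPrime N W K p ℓ → ¬ ℓ ∣ n →
    ∀ v : HeightOneSpectrum (𝓞 K), (ℓ : 𝓞 K) ∈ v.asIdeal →
      (d.kolyvaginClass m (n * ℓ) ∈ (W.baseChange K).torsionLocalKer (v.adicCompletion K) (p : ℤ) ↔
        d.kolyvaginClass m n ∈ (W.baseChange K).torsionLocalKer (v.adicCompletion K) (p : ℤ)) :=
  Iff.rfl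

/-- Unfolding `HasConjSign`. [cite: GrossLMS1991, Prop. 5.4 (2)] [cite: WZhang2014, §8.2 (p. 237)] -/
theorem hasConjSign_iff (d : ZhangLevelRaisedKolyvaginData N W K a p yK) (c : K ≃ₐ[ℚ] K) (ε : Finset ℕ → Bool) : d.HasConjSign c ε ↔
    ∀ m : Finset ℕ, IsZhangAdmissibleLevel N K a p m → m.Nonempty → Even m.card →
    ∀ n : ℕ, IsKolyvaginLevel N W K p n →
      conjAct W c (p : ℤ) (d.kolyvaginClass m n) =
        (if (ε m ^^ Nat.bodd n.primeFactors.card) then (1 : ℤ) else -1) • d.kolyvaginClass m n :=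
  Iff.rfl

end ZhangLevelRaisedKolyvaginData

end Literature.NumberTheory.EllipticCurves

end
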